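import Summits.SmoothPoincare4.SmoothPoincare4.Theses.DottedCircleRasmussen
import Summits.SmoothPoincare4.SmoothPoincare4.Theses.SchoenfliesSplit
import Literature.Topology.FourManifolds.MMSWRasmussenFacts
import Summits.SmoothPoincare4.SmoothPoincare4.Theorems.DottedCircleRasmussenDcrGfgmw
import Summits.SmoothPoincare4.SmoothPoincare4.Theorems.DcrRigidity.Negative.NonInvertibleWitness
import Summits.SmoothPoincare4.SmoothPoincare4.Theorems.DottedCircleRasmussenDcrRigidityStubOffPoint
import Summits.SmoothPoincare4.SmoothPoincare4.Theorems.DottedCircleRasmussenDcrRigidityStubInvOfSchsplit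

/-!
# SmoothPoincare4 / DottedCircleRasmussen — crux `DcrRigidity` (stmt-SmoothPoincare4-17014), line `Sketch`:
# the reduction `SchsplitPuncturedEmbeds → DcrRigidity` (conditional result) and its kill edge

The kill switch `DcrRigidity := ¬ DcrGap` of route `DottedCircleRasmussen` — every model circle
`K ⊂ ∂D_k` bounding a smooth proper disc in the complement of `e(D_k)` inside SOME homotopy
4-sphere `M` bounds such a disc in some `N ≅ S⁴` — follows from INVERTIBILITY of homotopy
4-spheres: if a puncture `M ∖ {q}` off the chart and the disc embeds smoothly in `S⁴`, the whole
slice datum `(e, f)` rides along the embedding (transplant; no disc is moved or made rigid).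
"Every punctured homotopy 4-sphere embeds in `ℝ⁴`" is VERBATIM the crux
`SchoenfliesSplit.SchsplitPuncturedEmbeds` (item stmt-SmoothPoincare4-0371) of another route, so
this file lands

* `transplant_of_punctureEmbeds` — a datum missing `q` plus a smooth embedding `M ∖ {q} ↪ S⁴`
  give a datum in `S⁴` (corestriction `DcrRigidity.Negative.isSliceDiscInComplement_codRestrict` +
  `DcrGfgmw.isSliceDiscInComplement_comp`);
* `dcrRigidity_of_punctureEmbeds` — pointwise invertibility (every puncture of every homotopy
  4-sphere, route binders, embeds in `S⁴`) ⇒ `DcrRigidity`, through the landed line stubs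
  `stub_offPoint` (re-choose the datum off a point) and the transplant;
* `dcrRigidity_of_schsplitPuncturedEmbeds : SchsplitPuncturedEmbeds → DcrRigidity` — the crux,
  CONDITIONAL on item stmt-SmoothPoincare4-0371 (packaging `stub_invOfSchsplit`, landed);
* `not_schsplitPuncturedEmbeds_of_dcrGap : DcrGap → ¬ SchsplitPuncturedEmbeds` — the cross-route
  kill edge: a one-handle slice gap lives on a NON-INVERTIBLE homotopy sphere and refutes crux (A)
  of `SchoenfliesSplit`;
* `dcrRigidity_of_smoothPoincare4` — the upper edge of the hardness sandwich
  `SmoothPoincare4 ⇒ DcrRigidity ⇒ ¬(FGMW gap)` (the lower edge is the landed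
  `DcrGap.Negative.not_fgmw_of_not_dcrGap`), recording why the apex is SPC4-adjacent.

This is the composition `DcrRigidity_of` of the registered skeleton `Cruxes/DcrRigidity/Lines/Sketch.lean`
with its one open stub X = `SchsplitPuncturedEmbeds` displayed as a hypothesis.  The standing
disprover's `Theorems/DcrRigidity/Negative/NonInvertibleWitness.lean` proves the contrapositive
shape (`exists_nonInvertible_of_not_dcrRigidity`); the positive, NAMED-item form is what the route
ledger consumes.

References: M. Freedman, R. Gompf, S. Morrison, K. Walker, Quantum Topol. 1 (2010), §1, fn. 1
("the Schoenflies problem asks if there are invertible homotopy spheres") [FreedmanGompfMorrisonWalker2010];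
R. Palais, Proc. AMS 11 (1960), Thm. B [Palais1960]; C. Manolescu, M. Marengon, S. Sarkar,
M. Willis, Duke Math. J. 172 (2023), §9.3, Question 9.11 [ManolescuMarengonSarkarWillis2023].
-/

noncomputable section

-- the prescribed namespace `Summit.<P>.<Sub>.…` duplicates `SmoothPoincare4` (P = Sub)
set_option linter.dupNamespace false

open scoped Manifold ContDiff Topology ContinuousMap
open Set Function Metric
open Literature.Topology.FourManifolds Literature.Topology.FourManifolds.MMSW
open Summit.SmoothPoincare4.SmoothPoincare4.Theses.DottedCircleRasmussen
open Summit.SmoothPoincare4.SmoothPoincare4.Theses.SchoenfliesSplit (SchsplitPuncturedEmbeds)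

namespace Summit.SmoothPoincare4.SmoothPoincare4.Cruxes.DcrRigidity.Sketch

/-! ## The transplant through an `S⁴`-embeddable puncture -/

/-- **Transplant.** If `K` has a slice datum `(e, f)` in the complement of `e(D_k)` inside ANY
smooth 4-manifold `M`, and a puncture `M ∖ {q}` off the chart and the disc embeds smoothly in `S⁴`,
then `K` has such a datum in `S⁴`: corestrict to the open submanifold `M ∖ {q}`
(`DcrRigidity.Negative.isSliceDiscInComplement_codRestrict`) and compose with the embedding
(`DcrGfgmw.isSliceDiscInComplement_comp`). [cite: FreedmanGompfMorrisonWalker2010, §1] -/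
theorem transplant_of_punctureEmbeds {k : ℕ}
    {K : (Metric.sphere (0 : EuclideanSpace ℝ (Fin 2)) 1) → EuclideanSpace ℝ (Fin 4)}
    {M : Type*} [TopologicalSpace M] [T2Space M] [ChartedSpace (EuclideanSpace ℝ (Fin 4)) M]
    [IsManifold (𝓡 4) ∞ M] {e : EuclideanSpace ℝ (Fin 4) → M} {f : EuclideanSpace ℝ (Fin 2) → M}
    (h : IsSliceDiscInComplement k K M e f) {q : M} (hqe : q ∉ range e) (hqf : q ∉ range f)
    {ι : ↥((⟨{q}ᶜ, isOpen_compl_singleton⟩ : TopologicalSpace.Opens M)) →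
      Metric.sphere (0 : EuclideanSpace ℝ (Fin 5)) 1}
    (hι : Manifold.IsSmoothEmbedding (𝓡 4) (𝓡 4) ∞ ι) :
    ∃ (e' : EuclideanSpace ℝ (Fin 4) → Metric.sphere (0 : EuclideanSpace ℝ (Fin 5)) 1)
      (f' : EuclideanSpace ℝ (Fin 2) → Metric.sphere (0 : EuclideanSpace ℝ (Fin 5)) 1),
      IsSliceDiscInComplement k K (Metric.sphere (0 : EuclideanSpace ℝ (Fin 5)) 1) e' f' := by
  have heU : ∀ v, e v ∈ (⟨{q}ᶜ, isOpen_compl_singleton⟩ : TopologicalSpace.Opens M) := by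
    intro v (hv : e v ∈ ({q} : Set M))
    exact hqe ⟨v, hv⟩
  have hfU : ∀ y, f y ∈ (⟨{q}ᶜ, isOpen_compl_singleton⟩ : TopologicalSpace.Opens M) := by
    intro y (hy : f y ∈ ({q} : Set M))
    exact hqf ⟨y, hy⟩
  exact ⟨_, _, Theorems.DcrGfgmw.isSliceDiscInComplement_comp
    (Theorems.DcrRigidity.Negative.isSliceDiscInComplement_codRestrict h _ heU hfU) hι⟩

/-! ## Invertibility proves the kill switch -/

/-- **Pointwise invertibility ⇒ `DcrRigidity`.** If every puncture of every smooth homotopy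
4-sphere (Statement binders) embeds smoothly in `S⁴`, then `DcrRigidity`: unfold `¬ DcrGap`, take
the datum `(e, f)` in the witnessing `M`, re-choose it off a point `q` (line stub
`stub_offPoint`), transplant along `M ∖ {q} ↪ S⁴`, and feed the `S⁴`-datum to the no-disc clause
with `N := S⁴`, `Diffeomorph.refl`. [cite: FreedmanGompfMorrisonWalker2010, §1] -/
theorem dcrRigidity_of_punctureEmbeds
    (hInv : ∀ (M : Type) [TopologicalSpace M] [T2Space M] [SecondCountableTopology M]
      [ChartedSpace (EuclideanSpace ℝ (Fin 4)) M] [IsManifold (𝓡 4) ∞ M],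
      Nonempty (M ≃ₕ (Metric.sphere (0 : EuclideanSpace ℝ (Fin 5)) 1)) → ∀ q : M,
      ∃ ι : ↥((⟨{q}ᶜ, isOpen_compl_singleton⟩ : TopologicalSpace.Opens M)) →
          Metric.sphere (0 : EuclideanSpace ℝ (Fin 5)) 1,
        Manifold.IsSmoothEmbedding (𝓡 4) (𝓡 4) ∞ ι) :
    DcrRigidity := by
  rintro ⟨k, K, hK, ⟨M, i1, i2, i3, i4, i5, hM, e, f, hf⟩, hno⟩
  have hK' : IsModelKnot k K := hK
  obtain ⟨e', q, h', hqe, hqf⟩ :=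
    stub_offPoint (fun t => modelBoundary_subset_modelHandlebody (hK'.mem t)) hf
  obtain ⟨ι, hι⟩ := @hInv M i1 i2 i3 i4 i5 hM q
  obtain ⟨e'', f'', h''⟩ := transplant_of_punctureEmbeds h' hqe hqf hι
  exact hno _ ⟨Diffeomorph.refl _ _ _⟩ e'' f'' h''

/-- **`SchsplitPuncturedEmbeds → DcrRigidity`: the kill switch of `DottedCircleRasmussen` follows
from crux (A) of route `SchoenfliesSplit`** (item stmt-SmoothPoincare4-0371: every punctured
homotopy 4-sphere embeds smoothly in `ℝ⁴` — "every homotopy 4-sphere is invertible", the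
non-Schoenflies half of SPC4 in Freedman–Gompf–Morrison–Walker's splitting
`SPC4 ⟺ INV ∧ Schoenflies⁴`).  CONDITIONAL result: the hypothesis is an open problem (implied by
`SmoothPoincare4`).  The packaging of the route's `Type`-binder homotopy spheres into
`HomotopySphere 4` and of `ℝ⁴` into `S⁴` is the landed line stub `stub_invOfSchsplit`.
[cite: FreedmanGompfMorrisonWalker2010, §1] -/
theorem dcrRigidity_of_schsplitPuncturedEmbeds (hA : SchsplitPuncturedEmbeds) : DcrRigidity :=
  dcrRigidity_of_punctureEmbeds fun M _ _ _ _ _ hM q => stub_invOfSchsplit hA M hM q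

/-- **Kill edge: a one-handle slice gap refutes crux (A) of `SchoenfliesSplit`.** If `DcrGap`
holds, its witnessing homotopy sphere is NON-INVERTIBLE (no puncture embeds in `ℝ⁴`), so
`SchsplitPuncturedEmbeds` fails — route `SchoenfliesSplit` would break at (A), never at its
Schoenflies half. [cite: FreedmanGompfMorrisonWalker2010, §1] -/
theorem not_schsplitPuncturedEmbeds_of_dcrGap (hX : DcrGap) : ¬ SchsplitPuncturedEmbeds :=
  fun hA => dcrRigidity_of_schsplitPuncturedEmbeds hA hX

/-! ## Hardness record -/

/-- **Upper edge of the sandwich `SmoothPoincare4 ⇒ DcrRigidity ⇒ ¬(FGMW gap)`**: the summit gives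
the kill switch outright (contrapositive of the route's certified deciding theorem `closes`: the
witnessing homotopy sphere is itself an admissible `N ≅ S⁴`).  The lower edge is the landed
`DcrGap.Negative.not_fgmw_of_not_dcrGap : ¬ DcrGap → ¬ ∃ K, K.IsHomotopyBallSlice ∧ ¬ K.IsSmoothlySlice`
(`k = 0`: every knot slice in a homotopy 4-ball would be slice in `B⁴` — the negation of the
Freedman–Gompf–Morrison–Walker / Manolescu–Piccirillo target, MMSW Question 9.11).  Both ends are
open, so no input short of SPC4-strength rigidity closes the crux, and the line's apex
`SchsplitPuncturedEmbeds` (⟸ `SmoothPoincare4`) sits between `SmoothPoincare4` and `DcrRigidity`.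
[cite: ManolescuMarengonSarkarWillis2023, Question 9.11] -/
theorem dcrRigidity_of_smoothPoincare4 (hS : _root_.SmoothPoincare4) : DcrRigidity :=
  fun hX => closes hX hS

end Summit.SmoothPoincare4.SmoothPoincare4.Cruxes.DcrRigidity.Sketch

end
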